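import Literature.InformationTheory.Coding.VasilevCodes
import Literature.InformationTheory.Coding.BinaryHammingCodes
import HarnessLib

/-!
# Vasil'ev codes exist for every `m ≥ 3` (MacWilliams–Sloane Ch. 2 §9 Problem (18), last sentence): a perfect
# single-error-correcting binary code of length `2^{m+1} − 1` with `2^{2n−m}` words (`n = 2^m − 1`) which is not
# equivalent to any linear code

Layer `Literature/InformationTheory/Coding`, namespace `Literature.InformationTheory.Coding.Vasilev` (lane
`lit-hodgefound`, prover seat `lit-hodgefound-p23`, row «A4-17(cv)» FILE 2: FILE 1 `VasilevCodes.lean` is the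
construction for an arbitrary perfect single-error-correcting `𝒞` and a strictly nonlinear `λ`; here `𝒞 = ℋ_m`, the
Hamming code of `BinaryHammingCodes.lean` (length `n = 2^m − 1` on the index type `Pos m` of nonzero vectors of
`𝔽₂^m`, perfect by `BinaryHammingCode.card_code_mul`, `d = 3`), and `λ` = the indicator of one nonzero codeword,
which is strictly nonlinear as soon as `ℋ_m` has two distinct nonzero codewords, i.e. `m ≥ 3`).

Source (held text `book:macwilliamsnd-theory-error-correcting-codes-gx73440325`, Ch. 2 §9 Problem (18) [p0070 L7]):
"… Show that such codes exist for all `m ≥ 3`."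

## What is here (theorems only; no definition, no named fact, net debt `0`)

* `indicator_strictly_nonlinear`: for distinct nonzero `c₀, c₁ ∈ ℋ_m` the indicator `λ = [· = c₀]` has
  `λ(c₀ + c₁) ≠ λ(c₀) + λ(c₁)`;
* `card_hammingCode_gt_two` (`m ≥ 3 ⇒ |ℋ_m| > 2`), `exists_two_nonzero_codewords`;
* **`exists_vasilev`**: for every `m ≥ 3`, on the index type `(Pos m ⊕ Pos m) ⊕ Unit` of cardinality `2^{m+1} − 1`,
  the Vasil'ev code `𝒱 = code (ℋ_m) λ` has `2ⁿ · |ℋ_m|` words, minimum distance `≥ 3`, is perfect (every word within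
  distance `1` of exactly one codeword), contains `0`, and no permutation-plus-translation image of it is an additive
  subgroup (a linear code).

## References

* [MacWilliamsSloane1977] F. J. MacWilliams, N. J. A. Sloane, *The Theory of Error-Correcting Codes*, North-Holland
  (1977), Ch. 2 §9 Problem (18) (p. 77; held chunk p0070); Ch. 1 §7 Theorem 8 (Hamming codes are perfect) (p0031).
-/

namespace Literature.InformationTheory.Coding

namespace Vasilev

open Finset
open BinaryHammingCode (Pos)

/-- For distinct nonzero codewords `c₀ ≠ c₁` (of any binary code closed under `+`), the indicator `λ = [· = c₀]` is
strictly nonlinear: `λ(c₀ + c₁) = 0 ≠ 1 = λ(c₀) + λ(c₁)`. [cite: MacWilliamsSloane1977, Ch. 2 §9 Problem (18)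
("which is strictly nonlinear: λ(u + v) ≠ λ(u) + λ(v) for some u, v ∈ 𝒞") (p0070)] -/
theorem indicator_strictly_nonlinear {κ : Type*} [Fintype κ] {c₀ c₁ : κ → ZMod 2} (h₁ : c₁ ≠ 0) (h01 : c₁ ≠ c₀) :
    (if c₀ + c₁ = c₀ then (1 : ZMod 2) else 0) ≠ (if c₀ = c₀ then (1 : ZMod 2) else 0) + if c₁ = c₀ then 1 else 0 := by
  rw [if_neg (fun h => h₁ (by simpa using h)), if_pos rfl, if_neg h01, add_zero]
  exact zero_ne_one

/-- `m + 3 ≤ 2^m` for `m ≥ 3`. [cite: MacWilliamsSloane1977, Ch. 2 §9 Problem (18) ("for all m ≥ 3") (p0070)] -/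
theorem add_three_le_two_pow {m : ℕ} (hm : 3 ≤ m) : m + 3 ≤ 2 ^ m := by
  induction m, hm using Nat.le_induction with
  | base => norm_num
  | succ k hk ih => rw [pow_succ]; omega

/-- **`ℋ_m` has more than two codewords when `m ≥ 3`** (`|ℋ_m| = 2^{2^m − 1 − m} ≥ 4`).
[cite: MacWilliamsSloane1977, Ch. 1 §7 ("dimension k = 2^r − 1 − r") (p0031); Ch. 2 §9 Problem (18) (p0070)] -/
theorem card_hammingCode_gt_two {m : ℕ} (hm : 3 ≤ m) : 2 < #(BinaryHammingCode.code m) := by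
  rw [BinaryHammingCode.card_code]
  have h := add_three_le_two_pow hm
  calc 2 < 2 ^ 2 := by norm_num
    _ ≤ 2 ^ (2 ^ m - 1 - m) := Nat.pow_le_pow_right (by norm_num) (by omega)

/-- Two distinct nonzero codewords of `ℋ_m`, `m ≥ 3`. [cite: MacWilliamsSloane1977, Ch. 2 §9 Problem (18) (p0070)] -/
theorem exists_two_nonzero_codewords {m : ℕ} (hm : 3 ≤ m) :
    ∃ c₀ ∈ BinaryHammingCode.code m, ∃ c₁ ∈ BinaryHammingCode.code m, c₀ ≠ 0 ∧ c₁ ≠ 0 ∧ c₁ ≠ c₀ := by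
  have hcard := card_hammingCode_gt_two hm
  have h0 : #((BinaryHammingCode.code m).erase 0) = #(BinaryHammingCode.code m) - 1 :=
    card_erase_of_mem (BinaryHammingCode.zero_mem_code (r := m))
  obtain ⟨c₀, hc₀⟩ : ((BinaryHammingCode.code m).erase 0).Nonempty := Finset.card_pos.1 (by omega)
  have h1 : #(((BinaryHammingCode.code m).erase 0).erase c₀) = #(BinaryHammingCode.code m) - 1 - 1 := by
    rw [card_erase_of_mem hc₀, h0]
  obtain ⟨c₁, hc₁⟩ : (((BinaryHammingCode.code m).erase 0).erase c₀).Nonempty := Finset.card_pos.1 (by omega)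
  exact ⟨c₀, mem_of_mem_erase hc₀, c₁, mem_of_mem_erase (mem_of_mem_erase hc₁), ne_of_mem_erase hc₀,
    ne_of_mem_erase (mem_of_mem_erase hc₁), ne_of_mem_erase hc₁⟩

/-- **Vasil'ev codes exist for all `m ≥ 3`.** With `𝒞 = ℋ_m` (the perfect `(2^m − 1, 2^{n−m}, 3)` Hamming code on the
index type `Pos m`, `n = |Pos m| = 2^m − 1`) and `λ` the indicator of a nonzero codeword, Vasil'ev's `𝒱` (on
`(Pos m ⊕ Pos m) ⊕ Unit`, of cardinality `2^{m+1} − 1`) has `2ⁿ|ℋ_m|` words, minimum distance `≥ 3`, is perfect,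
contains `0`, and is not equivalent (permutation of coordinates plus a constant vector) to any linear code.
[cite: MacWilliamsSloane1977, Ch. 2 §9 Problem (18) ("Show that such codes exist for all m ≥ 3") (p0070)] -/
theorem exists_vasilev {m : ℕ} (hm : 3 ≤ m) :
    ∃ (C : Finset (Pos m → ZMod 2)) (lam : (Pos m → ZMod 2) → ZMod 2),
      Fintype.card ((Pos m ⊕ Pos m) ⊕ Unit) = 2 ^ (m + 1) - 1 ∧
      #(code C lam) = 2 ^ (2 ^ m - 1) * 2 ^ (2 ^ m - 1 - m) ∧
      (∀ x ∈ code C lam, ∀ y ∈ code C lam, x ≠ y → 3 ≤ hammingDist x y) ∧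
      (∀ w, ∃! c, c ∈ code C lam ∧ hammingDist w c ≤ 1) ∧
      (0 : (Pos m ⊕ Pos m) ⊕ Unit → ZMod 2) ∈ code C lam ∧
      ∀ (σ : ((Pos m ⊕ Pos m) ⊕ Unit) ≃ ((Pos m ⊕ Pos m) ⊕ Unit)) (a : (Pos m ⊕ Pos m) ⊕ Unit → ZMod 2)
        (S : AddSubgroup ((Pos m ⊕ Pos m) ⊕ Unit → ZMod 2)),
        ¬ ∀ y, y ∈ S ↔ ∃ x ∈ code C lam, (fun i => x (σ i)) + a = y := by
  obtain ⟨c₀, hc₀, c₁, hc₁, h₀, h₁, h01⟩ := exists_two_nonzero_codewords hm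
  set C := BinaryHammingCode.code m with hC
  set lam : (Pos m → ZMod 2) → ZMod 2 := fun w => if w = c₀ then 1 else 0 with hlam
  have hC3 : ∀ c ∈ C, ∀ c' ∈ C, c ≠ c' → 3 ≤ hammingDist c c' := fun c hc c' hc' hne =>
    BinaryHammingCode.three_le_hammingDist hc hc' hne
  have hCcard : #C * (1 + Fintype.card (Pos m)) = 2 ^ Fintype.card (Pos m) := by
    rw [BinaryHammingCode.card_pos]; exact BinaryHammingCode.card_code_mul (r := m)
  have hlam0 : lam 0 = 0 := by rw [hlam]; dsimp only; rw [if_neg (Ne.symm h₀)]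
  have hne : lam (c₀ + c₁) ≠ lam c₀ + lam c₁ := by
    simpa only [hlam] using indicator_strictly_nonlinear h₁ h01
  refine ⟨C, lam, ?_, ?_, fun x hx y hy hxy => three_le_hammingDist_of_mem_code hC3 hx hy hxy,
    code_perfect hC3 hCcard, zero_mem_code (BinaryHammingCode.zero_mem_code (r := m)) hlam0,
    fun σ a S => not_equiv_linear (BinaryHammingCode.zero_mem_code (r := m)) hlam0 hc₀ hc₁ hne σ a S⟩
  · rw [Fintype.card_sum, Fintype.card_sum, Fintype.card_unit, BinaryHammingCode.card_pos, pow_succ]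
    have := Nat.one_le_two_pow (n := m)
    omega
  · rw [card_code, BinaryHammingCode.card_pos, BinaryHammingCode.card_code]

end Vasilev

end Literature.InformationTheory.Coding
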